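import Literature.Geometry.Kaehler.ChartTorusInner
import Literature.Geometry.Kaehler.TorusCutoffChain
import Literature.NumberTheory.Transcendental.KaehlerHodgeEllipticReductionProofs
import Literature.Analysis.FunctionSpaces.TorusMultiplierBound
import Literature.Analysis.FunctionSpaces.LatticeLocalRegularity
import Literature.Analysis.FunctionSpaces.LatticeDuality
import Mathlib.Analysis.Normed.Operator.Banach
import HarnessLib

/-!
# Local smooth representation of weak solutions (Warner 6.32 (5)–(8), the `M`-side of the regularity theorem)

F. W. Warner, GTM 94 (1983), 6.32: given a bounded functional `l'` on `E^p(M)` with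
`l'(Δ*φ) = ⟨f, φ⟩'`, one defines the local functional `l̃` on the torus (here: `c ↦ ℓ(mk(S(w₀ · synth c)))`
with the transfer `S` from the torus and a fixed cut-off `w₀`, WITHOUT Warner's `A⁻¹`, so that the
weak equation becomes the flat-adjoint equation), shows it is bounded in `H₀` (6.32 (6)), represents
it by `ũ ∈ H₀` (6.32 (8)), verifies the weak equation (6.32 (7)) — in our formulation against the flat
adjoint `L̃†`, with right-hand side the weighted transform `𝓕(W̃ Tα)` of `ChartTorusInner` — runs
the bootstrap of `LatticeLocalRegularity`, and obtains a smooth `u₀` on the torus with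
`𝓕u₀ = ω∞ ⋆ ũ`. This file: the functional (`localFunctional`), its bound and representation
(`exists_repr_localFunctional`), the weak equation (`weak_eq_local`), and the smooth
plateau representative (`exists_smooth_plateau_local`); then the end of the local step: the weight
operator `W(y)` (Warner's matrix `A` of 6.32 (2)) is invertible on the chart target with smooth
inverse, and the periodised cut-off inverse `W̃⁻¹` turns the smooth plateau representative `u₀`
(`𝓕u₀ = ω∞ ⋆ ũ`) into a smooth form `u_p = S(w₀ · W̃⁻¹ u₀)` on `M` with `ℓ(mk t) = ⟪mk u_p, mk t⟫`
for all smooth `t` supported in the chart preimage of the cube region of radius `ρ/8`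
(`exists_local_repr`; Warner: "`l(A⁻¹* ψ) = ⟨u_p, ψ⟩` … `l(φ) = ⟨A* u_p, φ⟩'`", our `W̃⁻¹` playing
the role of `(A*)⁻¹`).

## References

* F. W. Warner, GTM 94 (1983), 6.32 (5)–(16). [WarnerGTM94]
-/

noncomputable section

open scoped Manifold ContDiff Topology NNReal ENNReal ComplexConjugate ComplexInnerProductSpace
open Bundle Set Function Module Metric Complex Filter MeasureTheory UnitAddTorus
open Literature.Analysis.FunctionSpaces Literature.Analysis.FunctionSpaces.Torus Literature.NumberTheory.Transcendental

set_option maxSynthPendingDepth 2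

namespace Literature.Geometry.Kaehler

/-! ### Real form of a complex fibre identification; linearity of transfer and synthesis -/

section Helpers

variable {E : Type*} [NormedAddCommGroup E] [NormedSpace ℝ E] {n : ℕ}
  {M : Type*} [TopologicalSpace M] [ChartedSpace E M]
  {Λ : Type*} [NormedAddCommGroup Λ] [NormedSpace ℂ Λ] {V : Type*} [NormedAddCommGroup V] [NormedSpace ℂ V]

/-- A complex continuous linear equivalence as a real one. [folklore] -/
def realEquiv (ι : Λ ≃L[ℂ] V) : Λ ≃L[ℝ] V :=
  { ι.toLinearEquiv.restrictScalars ℝ with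
    continuous_toFun := ι.continuous
    continuous_invFun := ι.symm.continuous }

/-- The real equivalence as a map is the restriction of scalars. [folklore] -/
theorem coe_realEquiv (ι : Λ ≃L[ℂ] V) :
    ((realEquiv ι : Λ ≃L[ℝ] V) : Λ →L[ℝ] V) = (ι : Λ →L[ℂ] V).restrictScalars ℝ := by
  ext a; rfl

/-- Values of the real equivalence. [folklore] -/
@[simp] theorem realEquiv_apply (ι : Λ ≃L[ℂ] V) (a : Λ) : realEquiv ι a = ι a := rfl

/-- Values of the inverse real equivalence. [folklore] -/
@[simp] theorem realEquiv_symm_apply (ι : Λ ≃L[ℂ] V) (v : V) : (realEquiv ι).symm v = ι.symm v := rfl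

end Helpers

section TransferLinear

variable {E : Type*} [NormedAddCommGroup E] [NormedSpace ℝ E] {n : ℕ}
  {M : Type*} [TopologicalSpace M] [ChartedSpace E M] [IsManifold 𝓘(ℝ, E) ∞ M] {k : ℕ}
  {V : Type*} [NormedAddCommGroup V] [NormedSpace ℂ V]
  {p : M} {A : E ≃L[ℝ] EuclideanSpace ℝ (Fin n)} (ι : (E [⋀^Fin k]→L[ℝ] ℂ) ≃L[ℂ] V)

/-- The transfer from the torus is additive. [folklore] -/
theorem MForm.ofTorus_add (u u' : UnitAddTorus (Fin n) → V) :
    MForm.ofTorus p A (realEquiv ι) (u + u') = MForm.ofTorus p A (realEquiv ι) u + MForm.ofTorus p A (realEquiv ι) u' := by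
  rw [MForm.ofTorus, MForm.ofTorus, MForm.ofTorus, ← MForm.zeroExtend_add]
  congr 1
  funext y
  by_cases hy : ∀ i, cubeMap A (extChartAt 𝓘(ℝ, E) p p) y i ∈ Ioo (0 : ℝ) 1
  · simp only [Pi.add_apply, torusData_of_mem _ _ hy, map_add]
  · simp only [Pi.add_apply, torusData_of_not _ _ hy, add_zero]

omit [IsManifold 𝓘(ℝ, E) ∞ M] in
/-- The chart data commute with complex scalars. [folklore] -/
theorem torusData_smul_complex (c : ℂ) (u : UnitAddTorus (Fin n) → V) :
    torusData p A (realEquiv ι) (c • u) = c • torusData p A (realEquiv ι) u := by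
  funext y
  by_cases hy : ∀ i, cubeMap A (extChartAt 𝓘(ℝ, E) p p) y i ∈ Ioo (0 : ℝ) 1
  · simp only [torusData_of_mem _ _ hy, Pi.smul_apply, realEquiv_symm_apply, map_smul]
  · simp only [torusData_of_not _ _ hy, Pi.smul_apply, smul_zero]

/-- The extension by zero commutes with complex scalars. [folklore] -/
theorem MForm.zeroExtend_smul_complex (p : M) (c : ℂ) (γ : E → E [⋀^Fin k]→L[ℝ] ℂ) :
    MForm.zeroExtend p (c • γ) = c • MForm.zeroExtend p γ := by
  funext x
  by_cases hx : x ∈ (extChartAt 𝓘(ℝ, E) p).source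
  · ext v
    simp only [Pi.smul_apply, ContinuousAlternatingMap.smul_apply, MForm.zeroExtend_apply_of_mem p _ hx]
  · simp only [Pi.smul_apply, MForm.zeroExtend_apply_of_notMem p _ hx, smul_zero]

/-- The transfer from the torus commutes with complex scalars. [folklore] -/
theorem MForm.ofTorus_smul (c : ℂ) (u : UnitAddTorus (Fin n) → V) :
    MForm.ofTorus p A (realEquiv ι) (c • u) = c • MForm.ofTorus p A (realEquiv ι) u := by
  rw [MForm.ofTorus, MForm.ofTorus, torusData_smul_complex, MForm.zeroExtend_smul_complex]

/-- The transfer from the torus of a complex function multiple. [folklore] -/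
theorem MForm.ofTorus_fun_smul_apply (w : UnitAddTorus (Fin n) → ℂ) (u : UnitAddTorus (Fin n) → V) (x : M)
    (hx : x ∈ (extChartAt 𝓘(ℝ, E) p).source)
    (hy : ∀ i, cubeMap A (extChartAt 𝓘(ℝ, E) p p) (extChartAt 𝓘(ℝ, E) p x) i ∈ Ioo (0 : ℝ) 1) :
    MForm.ofTorus p A (realEquiv ι) (fun z ↦ w z • u z) x =
      w (Torus.proj (cubeMap A (extChartAt 𝓘(ℝ, E) p p) (extChartAt 𝓘(ℝ, E) p x))) •
        MForm.ofTorus p A (realEquiv ι) u x := by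
  ext v
  simp only [MForm.ofTorus, MForm.zeroExtend_apply_of_mem p _ hx, torusData_of_mem _ _ hy, realEquiv_symm_apply,
    map_smul, ContinuousAlternatingMap.smul_apply]

end TransferLinear

section Synth

variable {d : Type*} [Fintype d] {V : Type*} [NormedAddCommGroup V] [NormedSpace ℂ V] [CompleteSpace V]

/-- The Fourier synthesis is additive on rapidly decreasing families. [folklore] -/
theorem Torus.fourierSynth_add {c c' : (d → ℤ) → V} (hc : RapidDecay c) (hc' : RapidDecay c') :
    Torus.fourierSynth (c + c') = Torus.fourierSynth c + Torus.fourierSynth c' := by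
  funext x
  have h := (hc.hasSum_fourierSynth x).add (hc'.hasSum_fourierSynth x)
  have h2 := (hc.add hc').hasSum_fourierSynth x
  simp only [Pi.add_apply, smul_add] at h2
  exact h2.unique h

omit [CompleteSpace V] in
/-- The Fourier synthesis commutes with complex scalars. [folklore] -/
theorem Torus.fourierSynth_smul (a : ℂ) (c : (d → ℤ) → V) :
    Torus.fourierSynth (a • c) = a • Torus.fourierSynth c := by
  funext x
  simp only [Torus.fourierSynth, Pi.smul_apply, smul_comm _ a, tsum_const_smul'' a]

end Synth

/-! ### Radii and the fixed cut-off -/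

section LocalLight

variable {E : Type*} [NormedAddCommGroup E] [NormedSpace ℝ E] {n : ℕ}
  {M : Type*} [TopologicalSpace M] [ChartedSpace E M]
  {p : M} {A : E ≃L[ℝ] EuclideanSpace ℝ (Fin n)} (𝒞 : CubeCutoff p A)

/-- Cube regions are monotone in the radius. [folklore] -/
theorem cubeRegion_mono {r r' : ℝ} (h : r ≤ r') :
    cubeRegion A (extChartAt 𝓘(ℝ, E) p p) r ⊆ cubeRegion A (extChartAt 𝓘(ℝ, E) p p) r' :=
  fun _ hy ↦ closedBall_subset_closedBall h hy

/-- A cube region of radius `≤ ρ` lies in the chart target. [folklore] -/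
theorem cubeRegion_subset_target {r : ℝ} (h : r ≤ 𝒞.ρ) :
    cubeRegion A (extChartAt 𝓘(ℝ, E) p p) r ⊆ (extChartAt 𝓘(ℝ, E) p).target :=
  (cubeRegion_mono h).trans 𝒞.region_subset'

/-- Radii inequalities for the fixed cut-off `w₀ = ω_{5ρ/8, 3ρ/4}`. [folklore] -/
theorem localRadii : 0 < 5 * 𝒞.ρ / 8 ∧ 5 * 𝒞.ρ / 8 < 3 * 𝒞.ρ / 4 ∧ 3 * 𝒞.ρ / 4 < 1 / 2 ∧ 3 * 𝒞.ρ / 4 < 𝒞.ρ := by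
  have h1 := 𝒞.ρ_pos
  have h2 := 𝒞.ρ_lt_half
  refine ⟨by linarith, by linarith, by linarith, by linarith⟩

/-- Chain radii at `p`: `ρ/4 < ρ/2 < ½`. [folklore] -/
theorem chainRadii : 0 < 𝒞.ρ / 4 ∧ 𝒞.ρ / 4 < 𝒞.ρ / 2 ∧ 𝒞.ρ / 2 < 1 / 2 ∧ 𝒞.ρ / 2 < 5 * 𝒞.ρ / 8 := by
  have h1 := 𝒞.ρ_pos
  have h2 := 𝒞.ρ_lt_half
  refine ⟨by linarith, by linarith, by linarith, by linarith⟩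

/-- **The fixed cut-off `w₀`** of the local functional (`= 1` where `repr ∈ closedBall (5ρ/8)`,
supported where `repr ∈ ball (3ρ/4)`). [cite: WarnerGTM94, 6.32] -/
def localCutoff : UnitAddTorus (Fin n) → ℂ :=
  Torus.radialCutoff (n := n) (localRadii 𝒞).1 (localRadii 𝒞).2.1

/-- Support of `w₀ · g`: inside the image of `closedBall (3ρ/4)`. [folklore] -/
theorem localCutoff_smul_support {V : Type*} [AddCommGroup V] [Module ℂ V] (g : UnitAddTorus (Fin n) → V) (x : UnitAddTorus (Fin n))
    (hx : localCutoff 𝒞 x • g x ≠ 0) : Torus.repr x ∈ closedBall (Torus.cubeCenter (Fin n)) (3 * 𝒞.ρ / 4) := by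
  by_contra h
  exact hx (by rw [localCutoff, Torus.radialCutoff_eq_zero _ _ (localRadii 𝒞).2.2.1 (fun h' ↦ h (ball_subset_closedBall h')),
    zero_smul])

end LocalLight

/-! ### The local forms `S(w₀ · synth c)` -/

section LocalForms

variable {E : Type*} [NormedAddCommGroup E] [NormedSpace ℂ E] {n : ℕ}
  {M : Type*} [TopologicalSpace M] [ChartedSpace E M] [T2Space M] [IsManifold 𝓘(ℝ, E) ∞ M] {K N : ℕ}
  {p : M} {A : E ≃L[ℝ] EuclideanSpace ℝ (Fin n)} (ι : (E [⋀^Fin K]→L[ℝ] ℂ) ≃L[ℂ] EuclideanSpace ℂ (Fin N))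
  (𝒞 : CubeCutoff p A)

/-- The transfer `S(w₀ · synth c)` of a rapidly decreasing family: the form on `M`. [cite: WarnerGTM94, 6.32] -/
def localForm (c : (Fin n → ℤ) → EuclideanSpace ℂ (Fin N)) : MForm 𝓘(ℝ, E) M ℂ K :=
  MForm.ofTorus p A (realEquiv ι) fun x ↦ localCutoff 𝒞 x • Torus.fourierSynth c x

/-- `S(w₀ · synth c)` is smooth for rapidly decreasing `c`. [folklore] -/
theorem isSmoothForm_localForm {c : (Fin n → ℤ) → EuclideanSpace ℂ (Fin N)} (hc : RapidDecay c) :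
    IsSmoothForm (localForm ι 𝒞 c) := by
  refine isSmoothForm_ofTorus (realEquiv ι) (localRadii 𝒞).2.2.1
    (cubeRegion_subset_target 𝒞 (localRadii 𝒞).2.2.2.le) ?_ (localCutoff_smul_support 𝒞 _)
  exact (Torus.isSmooth_radialCutoff _ _ (localRadii 𝒞).2.2.1).smul_complex hc.isSmooth_fourierSynth


omit [T2Space M] in
/-- The local forms are additive in the family. [folklore] -/
theorem localForm_add {c c' : (Fin n → ℤ) → EuclideanSpace ℂ (Fin N)} (hc : RapidDecay c) (hc' : RapidDecay c') :
    localForm ι 𝒞 (c + c') = localForm ι 𝒞 c + localForm ι 𝒞 c' := by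
  rw [localForm, localForm, localForm, ← MForm.ofTorus_add, Torus.fourierSynth_add hc hc']
  congr 1
  funext x
  simp only [Pi.add_apply, smul_add]

omit [T2Space M] in
/-- The local forms commute with complex scalars. [folklore] -/
theorem localForm_smul (a : ℂ) (c : (Fin n → ℤ) → EuclideanSpace ℂ (Fin N)) :
    localForm ι 𝒞 (a • c) = a • localForm ι 𝒞 c := by
  rw [localForm, localForm, ← MForm.ofTorus_smul, Torus.fourierSynth_smul]
  congr 1
  funext x
  simp only [Pi.smul_apply, smul_comm a]

end LocalForms

/-! ### The local functional and its `H₀` representation (Warner 6.32 (6), (8)) -/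

section Local

variable {E : Type*} [NormedAddCommGroup E] [NormedSpace ℂ E] [FiniteDimensional ℂ E]
  {n : ℕ} [Fact (finrank ℝ E = n)] [MeasurableSpace E] [BorelSpace E]
  {M : Type*} [TopologicalSpace M] [ChartedSpace E M] [T2Space M] [CompactSpace M]
  [IsManifold 𝓘(ℝ, E) ∞ M] [RiemannianBundle (fun x : M ↦ TangentSpace 𝓘(ℝ, E) x)]
  [IsContMDiffRiemannianBundle 𝓘(ℝ, E) ∞ E (fun x : M ↦ TangentSpace 𝓘(ℝ, E) x)]
  (o : (x : M) → Orientation ℝ (TangentSpace 𝓘(ℝ, E) x) (Fin n)) {K N : ℕ}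
  [Fact (IsSmoothForm (riemannianVolumeForm o))]
  {p : M} {A : E ≃L[ℝ] EuclideanSpace ℝ (Fin n)} (ι : (E [⋀^Fin K]→L[ℝ] ℂ) ≃L[ℂ] EuclideanSpace ℂ (Fin N))
  (𝒞 : CubeCutoff p A)

/-- **The local functional `l̃`** on rapidly decreasing families: `c ↦ ℓ(mk(S(w₀ · synth c)))`
(Warner 6.32: `l̃ = l | C₀^∞(V)`, here composed with the transfer and without `A⁻¹`). [cite: WarnerGTM94, 6.32] -/
def localFunctional (ℓ : CL2SmoothForms o K →L[ℂ] ℂ) :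
    (Lattice.rapidDecaySubmodule : Submodule ℂ ((Fin n → ℤ) → EuclideanSpace ℂ (Fin N))) →ₗ[ℂ] ℂ where
  toFun c := ℓ (CL2SmoothForms.mk o (localForm ι 𝒞 (c : (Fin n → ℤ) → EuclideanSpace ℂ (Fin N)))
    (isSmoothForm_localForm ι 𝒞 c.2))
  map_add' c c' := by
    rw [← map_add]
    congr 1
    apply (CL2SmoothForms.toForm_inj o).1
    simp only [CL2SmoothForms.toForm_mk, CL2SmoothForms.toForm_add, Submodule.coe_add]
    exact localForm_add ι 𝒞 c.2 c'.2
  map_smul' a c := by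
    rw [RingHom.id_apply, ← map_smul]
    congr 1
    apply (CL2SmoothForms.toForm_inj o).1
    simp only [CL2SmoothForms.toForm_mk, CL2SmoothForms.toForm_smul, Submodule.coe_smul]
    exact localForm_smul ι 𝒞 a c

/-- Unfolding of the local functional. [folklore] -/
theorem localFunctional_apply (ℓ : CL2SmoothForms o K →L[ℂ] ℂ)
    (c : (Lattice.rapidDecaySubmodule : Submodule ℂ ((Fin n → ℤ) → EuclideanSpace ℂ (Fin N)))) :
    localFunctional o ι 𝒞 ℓ c = ℓ (CL2SmoothForms.mk o (localForm ι 𝒞 (c : (Fin n → ℤ) → EuclideanSpace ℂ (Fin N)))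
      (isSmoothForm_localForm ι 𝒞 c.2)) := rfl

/-- The `L²(𝕋ⁿ)` norm of the synthesis is the `H₀` norm of the family (Parseval). [folklore] -/
theorem integral_norm_sq_fourierSynth {c : (Fin n → ℤ) → EuclideanSpace ℂ (Fin N)} (hc : RapidDecay c) :
    ∫ x, ‖Torus.fourierSynth c x‖ ^ 2 = (Lattice.eNormSq 0 c).toReal := by
  have hs := Torus.hasSum_sq_mFourierCoeff_euclidean (hc.isSmooth_fourierSynth).continuous
  have h : Lattice.eNormSq 0 (mFourierCoeff (Torus.fourierSynth c)) = ENNReal.ofReal (∫ x, ‖Torus.fourierSynth c x‖ ^ 2) := by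
    rw [Lattice.eNormSq_zero_eq_tsum, ← hs.tsum_eq, ENNReal.ofReal_tsum_of_nonneg (fun _ ↦ by positivity) hs.summable]
    refine tsum_congr fun k ↦ ?_
    rw [← ofReal_norm, ← ENNReal.ofReal_pow (norm_nonneg _)]
  rw [funext hc.mFourierCoeff_fourierSynth] at h
  rw [h, ENNReal.toReal_ofReal (integral_nonneg fun _ ↦ by positivity)]

/-- **`l̃` is `H₀`-bounded** (Warner 6.32 (6): "`|l̃(φ)| ≤ const ‖φ‖`"), the constant coming from
`‖ℓ‖` and the norm dictionary on the cube of radius `3ρ/4`. [cite: WarnerGTM94, 6.32 (6)] -/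
theorem norm_localFunctional_le (ℓ : CL2SmoothForms o K →L[ℂ] ℂ) {εs : ℝ}
    (hsign : ∀ y ∈ cubeRegion A (extChartAt 𝓘(ℝ, E) p p) 𝒞.ρ, chartSign o p y = εs) :
    ∃ C : ℝ, ∀ c : (Lattice.rapidDecaySubmodule : Submodule ℂ ((Fin n → ℤ) → EuclideanSpace ℂ (Fin N))),
      ‖localFunctional o ι 𝒞 ℓ c‖ ≤ C * (Lattice.eNorm 0 (c : (Fin n → ℤ) → EuclideanSpace ℂ (Fin N))).toReal := by
  have hr := localRadii 𝒞
  have hKt : cubeRegion A (extChartAt 𝓘(ℝ, E) p p) (3 * 𝒞.ρ / 4) ⊆ (extChartAt 𝓘(ℝ, E) p).target :=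
    cubeRegion_subset_target 𝒞 hr.2.2.2.le
  obtain ⟨C₁, C₂, -, hb⟩ := CL2SmoothForms.exists_norm_sq_torus_bounds (k := K) o p A hr.2.2.1 hKt
    (fun y hy ↦ hsign y (cubeRegion_mono hr.2.2.2.le hy)) (realEquiv ι)
  refine ⟨‖ℓ‖ * Real.sqrt (max C₂ 0), fun c ↦ ?_⟩
  have hc : RapidDecay (c : (Fin n → ℤ) → EuclideanSpace ℂ (Fin N)) := c.2
  set g : UnitAddTorus (Fin n) → EuclideanSpace ℂ (Fin N) := fun x ↦ localCutoff 𝒞 x • Torus.fourierSynth c x with hg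
  have hsupp : ∀ x, localForm ι 𝒞 (c : (Fin n → ℤ) → EuclideanSpace ℂ (Fin N)) x ≠ 0 →
      x ∈ (extChartAt 𝓘(ℝ, E) p).source ∧ extChartAt 𝓘(ℝ, E) p x ∈ cubeRegion A (extChartAt 𝓘(ℝ, E) p p) (3 * 𝒞.ρ / 4) :=
    MForm.ofTorus_support (realEquiv ι) (localCutoff_smul_support 𝒞 _)
  have h2 := (hb (isSmoothForm_localForm ι 𝒞 hc) hsupp).2
  have hTS : MForm.toTorus p A ((realEquiv ι : (E [⋀^Fin K]→L[ℝ] ℂ) ≃L[ℝ] EuclideanSpace ℂ (Fin N)) :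
      (E [⋀^Fin K]→L[ℝ] ℂ) →L[ℝ] EuclideanSpace ℂ (Fin N)) (localForm ι 𝒞 c) = g :=
    MForm.toTorus_ofTorus (realEquiv ι) hr.2.2.1 hKt (localCutoff_smul_support 𝒞 _)
  rw [hTS] at h2
  -- `∫ ‖g‖² ≤ ∫ ‖synth c‖² = ‖c‖²_0`
  have hgc : Continuous g := ((Torus.isSmooth_radialCutoff _ _ hr.2.2.1).smul_complex hc.isSmooth_fourierSynth).continuous
  have hsc : Continuous (Torus.fourierSynth (c : (Fin n → ℤ) → EuclideanSpace ℂ (Fin N))) := hc.isSmooth_fourierSynth.continuous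
  have hle : ∫ x, ‖g x‖ ^ 2 ≤ (Lattice.eNormSq 0 (c : (Fin n → ℤ) → EuclideanSpace ℂ (Fin N))).toReal := by
    rw [← integral_norm_sq_fourierSynth hc]
    refine integral_mono ((hgc.norm.pow 2).integrable_unitAddTorus) ((hsc.norm.pow 2).integrable_unitAddTorus) fun x ↦ ?_
    simp only [hg, norm_smul]
    have h1 : ‖localCutoff 𝒞 x‖ ≤ 1 := Torus.norm_radialCutoff_le _ _ hr.2.2.1 x
    have h0 : 0 ≤ ‖localCutoff 𝒞 x‖ := norm_nonneg _
    rw [mul_pow]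
    have hN : 0 ≤ ‖Torus.fourierSynth (c : (Fin n → ℤ) → EuclideanSpace ℂ (Fin N)) x‖ ^ 2 := by positivity
    calc ‖localCutoff 𝒞 x‖ ^ 2 * ‖Torus.fourierSynth (c : (Fin n → ℤ) → EuclideanSpace ℂ (Fin N)) x‖ ^ 2
        ≤ 1 * ‖Torus.fourierSynth (c : (Fin n → ℤ) → EuclideanSpace ℂ (Fin N)) x‖ ^ 2 :=
          mul_le_mul_of_nonneg_right (pow_le_one₀ h0 h1) hN
      _ = _ := one_mul _
  -- assemble
  have hnorm : ‖CL2SmoothForms.mk o (localForm ι 𝒞 (c : (Fin n → ℤ) → EuclideanSpace ℂ (Fin N))) (isSmoothForm_localForm ι 𝒞 hc)‖ ≤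
      Real.sqrt (max C₂ 0) * (Lattice.eNorm 0 (c : (Fin n → ℤ) → EuclideanSpace ℂ (Fin N))).toReal := by
    have hsq : ‖CL2SmoothForms.mk o (localForm ι 𝒞 (c : (Fin n → ℤ) → EuclideanSpace ℂ (Fin N))) (isSmoothForm_localForm ι 𝒞 hc)‖ ^ 2 ≤
        max C₂ 0 * (Lattice.eNormSq 0 (c : (Fin n → ℤ) → EuclideanSpace ℂ (Fin N))).toReal :=
      h2.trans ((mul_le_mul_of_nonneg_right (le_max_left _ _) (integral_nonneg fun _ ↦ by positivity)).trans
        (mul_le_mul_of_nonneg_left hle (le_max_right _ _)))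
    have heq : (Lattice.eNorm 0 (c : (Fin n → ℤ) → EuclideanSpace ℂ (Fin N))).toReal =
        Real.sqrt ((Lattice.eNormSq 0 (c : (Fin n → ℤ) → EuclideanSpace ℂ (Fin N))).toReal) := by
      rw [Lattice.eNorm_eq_rpow, ← ENNReal.toReal_rpow, Real.sqrt_eq_rpow]
    rw [heq, ← Real.sqrt_mul (le_max_right _ _)]
    exact Real.le_sqrt_of_sq_le hsq
  calc ‖localFunctional o ι 𝒞 ℓ c‖
      ≤ ‖ℓ‖ * ‖CL2SmoothForms.mk o (localForm ι 𝒞 (c : (Fin n → ℤ) → EuclideanSpace ℂ (Fin N))) (isSmoothForm_localForm ι 𝒞 hc)‖ :=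
        ℓ.le_opNorm _
    _ ≤ ‖ℓ‖ * (Real.sqrt (max C₂ 0) * (Lattice.eNorm 0 (c : (Fin n → ℤ) → EuclideanSpace ℂ (Fin N))).toReal) :=
        mul_le_mul_of_nonneg_left hnorm (norm_nonneg _)
    _ = ‖ℓ‖ * Real.sqrt (max C₂ 0) * (Lattice.eNorm 0 (c : (Fin n → ℤ) → EuclideanSpace ℂ (Fin N))).toReal := by ring

/-- **`l̃` is represented by `ũ ∈ H₀`** (Warner 6.32 (8)). [cite: WarnerGTM94, 6.32 (8)] -/
theorem exists_repr_localFunctional (ℓ : CL2SmoothForms o K →L[ℂ] ℂ) {εs : ℝ}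
    (hsign : ∀ y ∈ cubeRegion A (extChartAt 𝓘(ℝ, E) p p) 𝒞.ρ, chartSign o p y = εs) :
    ∃ û : (Fin n → ℤ) → EuclideanSpace ℂ (Fin N), Lattice.eNormSq 0 û < ⊤ ∧
      ∀ c : (Lattice.rapidDecaySubmodule : Submodule ℂ ((Fin n → ℤ) → EuclideanSpace ℂ (Fin N))),
        localFunctional o ι 𝒞 ℓ c = Lattice.pairing û c := by
  obtain ⟨C, hC⟩ := norm_localFunctional_le o ι 𝒞 ℓ hsign
  obtain ⟨û, hu, hrep⟩ := Lattice.exists_repr_of_norm_le (localFunctional o ι 𝒞 ℓ) (s := 0) hC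
  refine ⟨û, ?_, hrep⟩
  rw [neg_zero] at hu
  exact hu.trans_lt ENNReal.ofReal_lt_top

/-! ### The smooth weighted transform of `α` and the weak equation (Warner 6.32 (7)) -/

/-- **The weighted transform `W̃ Tα` as a smooth periodic function** (periodisation of the cut-off
chart data; equal to `x ↦ W̃(x) (Tα)(x)`). [cite: WarnerGTM94, 6.32] -/
def weightedTransform (εs : ℝ) (α : MForm 𝓘(ℝ, E) M ℂ K) : UnitAddTorus (Fin n) → EuclideanSpace ℂ (Fin N) :=
  Torus.periodize fun z ↦ 𝒞.χ z • weightOp o p A ι εs ((cubeMap A (extChartAt 𝓘(ℝ, E) p p)).symm z)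
    (ι (MForm.chartRep p α ((cubeMap A (extChartAt 𝓘(ℝ, E) p p)).symm z)))

omit [T2Space M] [CompactSpace M] [IsContMDiffRiemannianBundle 𝓘(ℝ, E) ∞ E (fun x : M ↦ TangentSpace 𝓘(ℝ, E) x)]
  [Fact (IsSmoothForm (riemannianVolumeForm o))] in
/-- Values of the weighted transform: `W̃(x) (Tα)(x)`. [folklore] -/
theorem weightedTransform_apply (εs : ℝ) (α : MForm 𝓘(ℝ, E) M ℂ K) (x : UnitAddTorus (Fin n)) :
    weightedTransform o ι 𝒞 εs α x = weightPer o ι 𝒞 εs x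
      (MForm.toTorus p A ((ι : (E [⋀^Fin K]→L[ℝ] ℂ) →L[ℂ] EuclideanSpace ℂ (Fin N)).restrictScalars ℝ) α x) := by
  rw [weightedTransform, Torus.periodize_eq_apply_repr (fun z hz ↦ by simp [𝒞.eq_zero_of_not hz]), weightPer,
    Torus.periodize_eq_apply_repr (fun z hz ↦ by simp [weightFun, 𝒞.eq_zero_of_not hz]), weightFun, MForm.toTorus_apply,
    FunLike.coe_smul, Pi.smul_apply]
  rfl

omit [T2Space M] [CompactSpace M] in
/-- The weighted transform of a smooth form is smooth. [folklore] -/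
theorem isSmooth_weightedTransform (εs : ℝ) {α : MForm 𝓘(ℝ, E) M ℂ K} (hα : IsSmoothForm α) :
    Torus.IsSmooth (weightedTransform o ι 𝒞 εs α) := by
  have hrep : ContDiffOn ℝ ∞ (MForm.chartRep p α) (extChartAt 𝓘(ℝ, E) p).target :=
    (hα.contDiffOn_inChart_target p).congr fun y hy ↦ MForm.chartRep_of_mem p _ hy
  have hin : ContDiffOn ℝ ∞ (fun y ↦ weightOp o p A ι εs y (ι (MForm.chartRep p α y))) (extChartAt 𝓘(ℝ, E) p).target :=
    (contDiffOn_weightOp o ι εs).clm_apply ((ι : (E [⋀^Fin K]→L[ℝ] ℂ) →L[ℂ] EuclideanSpace ℂ (Fin N)).restrictScalars ℝ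
      |>.contDiff.comp_contDiffOn hrep)
  refine Torus.isSmooth_periodize (contDiff_smul_of_tsupport_subset (CubeCutoff.isOpen_preimage_target p A) 𝒞.contDiff
    𝒞.tsupport_subset_preimage (hin.comp (contDiff_cubeMap_symm A _).contDiffOn fun _ hz ↦ hz)) (R := Fintype.card (Fin n)) ?_
  exact Torus.tsupport_subset_closedBall_of_openCube (((tsupport_smul_subset_left _ _).trans 𝒞.tsupport_subset).trans
    (closedBall_cubeCenter_subset 𝒞.ρ'_lt))

/-- **The weak equation on the lattice** (Warner 6.32 (7), flat-adjoint form): for the representing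
family `ũ` of `l̃` and smooth test functions `ψ` supported where `repr ∈ ball (5ρ/8)`,
`⟨ũ, L̃ ψ̂⟩ = ⟨𝓕(W̃ Tα), ψ̂⟩`, if `ℓ(Δφ) = ⟪α, φ⟫` on `A^K(M; ℂ)`, `Δ` is read by `L̃` on the torus
(`hagree`), preserves smoothness and chart supports. [cite: WarnerGTM94, 6.32 (7)] -/
theorem weak_eq_local {εs : ℝ} (hsign : ∀ y ∈ cubeRegion A (extChartAt 𝓘(ℝ, E) p p) 𝒞.ρ, chartSign o p y = εs)
    (Δ : MForm 𝓘(ℝ, E) M ℂ K → MForm 𝓘(ℝ, E) M ℂ K) (hΔs : ∀ {β}, IsSmoothForm β → IsSmoothForm (Δ β))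
    (hΔsupp : ∀ {β : MForm 𝓘(ℝ, E) M ℂ K} {r : ℝ}, IsSmoothForm β → r ≤ 𝒞.ρ →
      (∀ x, β x ≠ 0 → x ∈ (extChartAt 𝓘(ℝ, E) p).source ∧
        extChartAt 𝓘(ℝ, E) p x ∈ cubeRegion A (extChartAt 𝓘(ℝ, E) p p) r) →
      ∀ x, Δ β x ≠ 0 → x ∈ (extChartAt 𝓘(ℝ, E) p).source ∧
        extChartAt 𝓘(ℝ, E) p x ∈ cubeRegion A (extChartAt 𝓘(ℝ, E) p p) r)
    (ΔL : CL2SmoothForms o K → CL2SmoothForms o K)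
    (hΔL : ∀ φ, CL2SmoothForms.toForm o (ΔL φ) = Δ (CL2SmoothForms.toForm o φ))
    (Lop : Lattice.POp (Fin n) (EuclideanSpace ℂ (Fin N)) (EuclideanSpace ℂ (Fin N)))
    (hagree : ∀ {β : MForm 𝓘(ℝ, E) M ℂ K}, IsSmoothForm β →
      (∀ x, β x ≠ 0 → x ∈ (extChartAt 𝓘(ℝ, E) p).source ∧
        extChartAt 𝓘(ℝ, E) p x ∈ cubeRegion A (extChartAt 𝓘(ℝ, E) p p) 𝒞.ρ) →
      mFourierCoeff (MForm.toTorus p A ((ι : (E [⋀^Fin K]→L[ℝ] ℂ) →L[ℂ] EuclideanSpace ℂ (Fin N)).restrictScalars ℝ) (Δ β)) =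
        Lop.apply (mFourierCoeff (MForm.toTorus p A ((ι : (E [⋀^Fin K]→L[ℝ] ℂ) →L[ℂ] EuclideanSpace ℂ (Fin N)).restrictScalars ℝ) β)))
    (α : CL2SmoothForms o K) (ℓ : CL2SmoothForms o K →L[ℂ] ℂ) (hweakM : ∀ φ, ℓ (ΔL φ) = ⟪α, φ⟫)
    {û : (Fin n → ℤ) → EuclideanSpace ℂ (Fin N)}
    (hû : ∀ c : (Lattice.rapidDecaySubmodule : Submodule ℂ ((Fin n → ℤ) → EuclideanSpace ℂ (Fin N))),
      localFunctional o ι 𝒞 ℓ c = Lattice.pairing û c)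
    {ψ : UnitAddTorus (Fin n) → EuclideanSpace ℂ (Fin N)} (hψ : Torus.IsSmooth ψ)
    (hψs : tsupport ψ ⊆ {x | Torus.repr x ∈ ball (Torus.cubeCenter (Fin n)) (5 * 𝒞.ρ / 8)}) :
    Lattice.pairing û (Lop.apply (mFourierCoeff ψ)) =
      Lattice.pairing (mFourierCoeff (weightedTransform o ι 𝒞 εs (CL2SmoothForms.toForm o α))) (mFourierCoeff ψ) := by
  have hr := localRadii 𝒞
  have h58 : 5 * 𝒞.ρ / 8 < 1 / 2 := hr.2.1.trans hr.2.2.1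
  have hKt58 : cubeRegion A (extChartAt 𝓘(ℝ, E) p p) (5 * 𝒞.ρ / 8) ⊆ (extChartAt 𝓘(ℝ, E) p).target :=
    cubeRegion_subset_target 𝒞 (by linarith [hr.2.2.2])
  -- the coercion of the real equivalence is the restriction of scalars
  have hcoe := coe_realEquiv ι
  -- (a) support of `ψ`
  have ha : ∀ x, ψ x ≠ 0 → Torus.repr x ∈ closedBall (Torus.cubeCenter (Fin n)) (5 * 𝒞.ρ / 8) := fun x hx ↦
    ball_subset_closedBall (hψs (subset_tsupport _ hx))
  -- (b) the form `β = S ψ`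
  set β : MForm 𝓘(ℝ, E) M ℂ K := MForm.ofTorus p A (realEquiv ι) ψ with hβdef
  have hβ : IsSmoothForm β := isSmoothForm_ofTorus (realEquiv ι) h58 hKt58 hψ ha
  have hKβ58 : ∀ x, β x ≠ 0 → x ∈ (extChartAt 𝓘(ℝ, E) p).source ∧
      extChartAt 𝓘(ℝ, E) p x ∈ cubeRegion A (extChartAt 𝓘(ℝ, E) p p) (5 * 𝒞.ρ / 8) :=
    MForm.ofTorus_support (realEquiv ι) ha
  have hKβρ : ∀ x, β x ≠ 0 → x ∈ (extChartAt 𝓘(ℝ, E) p).source ∧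
      extChartAt 𝓘(ℝ, E) p x ∈ cubeRegion A (extChartAt 𝓘(ℝ, E) p p) 𝒞.ρ := fun x hx ↦
    ⟨(hKβ58 x hx).1, cubeRegion_mono (by linarith [hr.2.2.2]) (hKβ58 x hx).2⟩
  -- (c) `T β = ψ`
  have hc : MForm.toTorus p A ((ι : (E [⋀^Fin K]→L[ℝ] ℂ) →L[ℂ] EuclideanSpace ℂ (Fin N)).restrictScalars ℝ) β = ψ := by
    rw [← hcoe]; exact MForm.toTorus_ofTorus (realEquiv ι) h58 hKt58 ha
  -- (d) `Δβ`
  have hΔβ : IsSmoothForm (Δ β) := hΔs hβ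
  have hKΔβ : ∀ x, Δ β x ≠ 0 → x ∈ (extChartAt 𝓘(ℝ, E) p).source ∧
      extChartAt 𝓘(ℝ, E) p x ∈ cubeRegion A (extChartAt 𝓘(ℝ, E) p p) (5 * 𝒞.ρ / 8) :=
    hΔsupp hβ (by linarith [hr.2.2.2]) hKβ58
  have hKΔβρ : ∀ x, Δ β x ≠ 0 → x ∈ (extChartAt 𝓘(ℝ, E) p).source ∧
      extChartAt 𝓘(ℝ, E) p x ∈ cubeRegion A (extChartAt 𝓘(ℝ, E) p p) 𝒞.ρ := fun x hx ↦
    ⟨(hKΔβ x hx).1, cubeRegion_mono (by linarith [hr.2.2.2]) (hKΔβ x hx).2⟩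
  -- (f) the torus function `T(Δβ)` and its coefficients
  set θ := MForm.toTorus p A ((ι : (E [⋀^Fin K]→L[ℝ] ℂ) →L[ℂ] EuclideanSpace ℂ (Fin N)).restrictScalars ℝ) (Δ β) with hθ
  have hθs : Torus.IsSmooth θ := MForm.isSmooth_toTorus _ 𝒞.ρ_lt_half hΔβ 𝒞.region_subset' hKΔβρ
  have hθr : RapidDecay (mFourierCoeff θ) := hθs.rapidDecay_mFourierCoeff
  have he : Lop.apply (mFourierCoeff ψ) = mFourierCoeff θ := by rw [← hc, hθ]; exact (hagree hβ hKβρ).symm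
  -- (g) `localForm (𝓕 θ) = Δβ`
  have hθsupp : ∀ x, θ x ≠ 0 → Torus.repr x ∈ closedBall (Torus.cubeCenter (Fin n)) (5 * 𝒞.ρ / 8) := fun x hx ↦
    MForm.toTorus_support _ hKΔβ x hx
  have hg : localForm ι 𝒞 (mFourierCoeff θ) = Δ β := by
    have h1 : Torus.fourierSynth (mFourierCoeff θ) = θ :=
      Torus.fourierSynth_mFourierCoeff_of_summable hθs.continuous hθr.summable_norm
    have h2 : (fun x ↦ localCutoff 𝒞 x • Torus.fourierSynth (mFourierCoeff θ) x) = θ := by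
      rw [h1]; funext x
      by_cases hx : θ x = 0
      · rw [hx, smul_zero]
      · rw [localCutoff, Torus.radialCutoff_eq_one _ _ hr.2.2.1 (hθsupp x hx), one_smul]
    rw [localForm, h2, hθ, ← hcoe]
    exact MForm.ofTorus_toTorus (realEquiv ι) h58 hKΔβ
  -- (h) the left-hand side
  have hmk : CL2SmoothForms.mk o (localForm ι 𝒞 (mFourierCoeff θ)) (isSmoothForm_localForm ι 𝒞 hθr) =
      ΔL (CL2SmoothForms.mk o β hβ) := by
    apply (CL2SmoothForms.toForm_inj o).1
    rw [CL2SmoothForms.toForm_mk, hΔL, CL2SmoothForms.toForm_mk, hg]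
  have hLHS : Lattice.pairing û (Lop.apply (mFourierCoeff ψ)) = ⟪α, CL2SmoothForms.mk o β hβ⟫ := by
    have h1 := hû ⟨mFourierCoeff θ, hθr⟩
    rw [localFunctional_apply] at h1
    change ℓ (CL2SmoothForms.mk o (localForm ι 𝒞 (mFourierCoeff θ)) (isSmoothForm_localForm ι 𝒞 hθr)) =
      Lattice.pairing û (mFourierCoeff θ) at h1
    rw [he, ← h1, hmk, hweakM]
  -- the right-hand side
  have hW : ∀ x, ⟪weightOp o p A ι εs ((cubeMap A (extChartAt 𝓘(ℝ, E) p p)).symm (Torus.repr x))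
      (MForm.toTorus p A ((ι : (E [⋀^Fin K]→L[ℝ] ℂ) →L[ℂ] EuclideanSpace ℂ (Fin N)).restrictScalars ℝ)
        (CL2SmoothForms.toForm o α) x),
      MForm.toTorus p A ((ι : (E [⋀^Fin K]→L[ℝ] ℂ) →L[ℂ] EuclideanSpace ℂ (Fin N)).restrictScalars ℝ) β x⟫ =
      ⟪weightedTransform o ι 𝒞 εs (CL2SmoothForms.toForm o α) x, ψ x⟫ := fun x ↦ by
    rw [hc]
    by_cases hx : ψ x = 0
    · simp [hx]
    · rw [weightedTransform_apply, weightPer_apply_of_mem o ι 𝒞 εs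
        (closedBall_subset_closedBall (by linarith [hr.2.2.2]) (ha x hx))]
  rw [hLHS, ← CL2SmoothForms.mk_toForm o α, CL2SmoothForms.inner_mk_eq_integral_inner_weightOp o ι 𝒞 hsign
      (CL2SmoothForms.isSmoothForm_toForm o α) hβ hKβρ,
    integral_congr_ae (Eventually.of_forall hW), CL2SmoothForms.mk_toForm,
    Torus.pairing_mFourierCoeff_eq_integral_inner (isSmooth_weightedTransform o ι 𝒞 εs (CL2SmoothForms.isSmoothForm_toForm o α)).continuous
      hψ.continuous]

/-! ### The smooth plateau representative (Warner 6.32 (9)–(16) applied) -/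

/-- **The smooth local representative on the torus** (Warner 6.32 (16) with the final plateau):
under the hypotheses of `weak_eq_local` and, in addition, an elliptic lattice operator `L̃†` with
small perturbation in duality with `L̃` (`hdual`), there is a smooth `u₀` on `𝕋ⁿ` with
`𝓕u₀ = ω∞ ⋆ ũ`, `ω∞ = radialPlateau (ρ/4)` (`= 1` where `repr ∈ closedBall (ρ/8)`).
[cite: WarnerGTM94, 6.32 (16)] -/
theorem exists_smooth_plateau_local {εs : ℝ} (hsign : ∀ y ∈ cubeRegion A (extChartAt 𝓘(ℝ, E) p p) 𝒞.ρ, chartSign o p y = εs)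
    (Δ : MForm 𝓘(ℝ, E) M ℂ K → MForm 𝓘(ℝ, E) M ℂ K) (hΔs : ∀ {β}, IsSmoothForm β → IsSmoothForm (Δ β))
    (hΔsupp : ∀ {β : MForm 𝓘(ℝ, E) M ℂ K} {r : ℝ}, IsSmoothForm β → r ≤ 𝒞.ρ →
      (∀ x, β x ≠ 0 → x ∈ (extChartAt 𝓘(ℝ, E) p).source ∧
        extChartAt 𝓘(ℝ, E) p x ∈ cubeRegion A (extChartAt 𝓘(ℝ, E) p p) r) →
      ∀ x, Δ β x ≠ 0 → x ∈ (extChartAt 𝓘(ℝ, E) p).source ∧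
        extChartAt 𝓘(ℝ, E) p x ∈ cubeRegion A (extChartAt 𝓘(ℝ, E) p p) r)
    (ΔL : CL2SmoothForms o K → CL2SmoothForms o K)
    (hΔL : ∀ φ, CL2SmoothForms.toForm o (ΔL φ) = Δ (CL2SmoothForms.toForm o φ))
    (Lop Ladj : Lattice.POp (Fin n) (EuclideanSpace ℂ (Fin N)) (EuclideanSpace ℂ (Fin N)))
    (hagree : ∀ {β : MForm 𝓘(ℝ, E) M ℂ K}, IsSmoothForm β →
      (∀ x, β x ≠ 0 → x ∈ (extChartAt 𝓘(ℝ, E) p).source ∧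
        extChartAt 𝓘(ℝ, E) p x ∈ cubeRegion A (extChartAt 𝓘(ℝ, E) p p) 𝒞.ρ) →
      mFourierCoeff (MForm.toTorus p A ((ι : (E [⋀^Fin K]→L[ℝ] ℂ) →L[ℂ] EuclideanSpace ℂ (Fin N)).restrictScalars ℝ) (Δ β)) =
        Lop.apply (mFourierCoeff (MForm.toTorus p A ((ι : (E [⋀^Fin K]→L[ℝ] ℂ) →L[ℂ] EuclideanSpace ℂ (Fin N)).restrictScalars ℝ) β)))
    (hdual : ∀ {u v : (Fin n → ℤ) → EuclideanSpace ℂ (Fin N)}, Lattice.Tempered u → RapidDecay v →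
      Lattice.pairing (Ladj.apply u) v = Lattice.pairing u (Lop.apply v))
    {κ : ℝ} (hκ : 0 < κ) (hell : Ladj.IsEllipticWith κ) {ε : ℝ≥0∞} (hpert : Ladj.PrincipalPerturbationLE ε)
    (hε : ENNReal.ofReal (2 * Real.sqrt 2 / κ) * (Fintype.card (Fin n) : ℝ≥0∞) ^ 2 * ε ≤ 1)
    (α : CL2SmoothForms o K) (ℓ : CL2SmoothForms o K →L[ℂ] ℂ) (hweakM : ∀ φ, ℓ (ΔL φ) = ⟪α, φ⟫)
    {û : (Fin n → ℤ) → EuclideanSpace ℂ (Fin N)} (hu : Lattice.eNormSq 0 û < ⊤)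
    (hû : ∀ c : (Lattice.rapidDecaySubmodule : Submodule ℂ ((Fin n → ℤ) → EuclideanSpace ℂ (Fin N))),
      localFunctional o ι 𝒞 ℓ c = Lattice.pairing û c) :
    ∃ u₀ : UnitAddTorus (Fin n) → EuclideanSpace ℂ (Fin N), Torus.IsSmooth u₀ ∧
      mFourierCoeff u₀ = Lattice.conv (Lattice.scal (mFourierCoeff (Torus.radialPlateau (n := n) (chainRadii 𝒞).1))) û := by
  have hc := chainRadii 𝒞
  have hr := localRadii 𝒞
  set w : ℕ → UnitAddTorus (Fin n) → ℂ := Torus.radialChain (n := n) hc.1 hc.2.1 with hw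
  refine Lattice.exists_isSmooth_plateau_conv Ladj Lop.apply hdual hκ hell hpert hε hu
    (isSmooth_weightedTransform o ι 𝒞 εs (CL2SmoothForms.isSmoothForm_toForm o α)).rapidDecay_mFourierCoeff (w := w)
    (fun j ↦ ⟨_, Torus.radialCutoff_eq_ofReal _ _ ((chainRadius_le hc.2.1 j).trans_lt hc.2.2.1)⟩)
    (fun j ↦ Torus.plateauPair_radialChain_succ hc.1 hc.2.1 hc.2.2.1 j) (fun ψ hψ hψs ↦ ?_)
    (fun j ↦ Torus.plateauPair_radialPlateau hc.1 hc.2.1 hc.2.2.1 j)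
  refine weak_eq_local o ι 𝒞 hsign Δ hΔs hΔsupp ΔL hΔL Lop hagree α ℓ hweakM hû hψ (hψs.trans ?_)
  -- `tsupport ω₀ ⊆ {repr ∈ ball (5ρ/8)}`
  exact Torus.tsupport_radialCutoff_subset _ _ ((chainRadius_le hc.2.1 0).trans_lt hc.2.2.1)
    ((chainRadius_le hc.2.1 0).trans_lt hc.2.2.2) (hr.2.1.trans hr.2.2.1)

end Local


/-! ### Invertibility of the weight operator -/

section WeightInv

variable {E : Type*} [NormedAddCommGroup E] [NormedSpace ℂ E] [FiniteDimensional ℂ E]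
  {n : ℕ} [Fact (finrank ℝ E = n)] [MeasurableSpace E] [BorelSpace E]
  {M : Type*} [TopologicalSpace M] [ChartedSpace E M] [T2Space M] [CompactSpace M]
  [IsManifold 𝓘(ℝ, E) ∞ M] [RiemannianBundle (fun x : M ↦ TangentSpace 𝓘(ℝ, E) x)]
  [IsContMDiffRiemannianBundle 𝓘(ℝ, E) ∞ E (fun x : M ↦ TangentSpace 𝓘(ℝ, E) x)]
  (o : (x : M) → Orientation ℝ (TangentSpace 𝓘(ℝ, E) x) (Fin n)) {j N : ℕ}
  [Fact (IsSmoothForm (riemannianVolumeForm o))]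
  (p : M) (A : E ≃L[ℝ] EuclideanSpace ℝ (Fin n)) (ι : (E [⋀^Fin j]→L[ℝ] ℂ) ≃L[ℂ] EuclideanSpace ℂ (Fin N))

omit [MeasurableSpace E] [BorelSpace E] [T2Space M] [CompactSpace M]
  [IsContMDiffRiemannianBundle 𝓘(ℝ, E) ∞ E (fun x : M ↦ TangentSpace 𝓘(ℝ, E) x)]
  [Fact (IsSmoothForm (riemannianVolumeForm o))] in
/-- **Definiteness of the frame weight**: `frameInnerC y A A = 0 → A = 0` for `y` in the chart
target (via the real definiteness `innerChart_self_eq_zero_iff` of the real and imaginary parts).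
[cite: WarnerGTM94, 6.32 (2)] -/
theorem frameInnerC_self_eq_zero {y : E} (hy : y ∈ (extChartAt 𝓘(ℝ, E) p).target) (B : E [⋀^Fin j]→L[ℝ] ℂ)
    (h : frameInnerC (I := 𝓘(ℝ, E)) n j p y B B = 0) : B = 0 := by
  -- each frame value vanishes
  have hs : ∀ s : Set.powersetCard (Fin n) j, B (frameTuple p s y) = 0 := by
    have hsum : ∑ s : Set.powersetCard (Fin n) j, (‖B (frameTuple p s y)‖ ^ 2 : ℝ) = 0 := by
      have : (frameInnerC (I := 𝓘(ℝ, E)) n j p y B B).re = ∑ s : Set.powersetCard (Fin n) j, ‖B (frameTuple p s y)‖ ^ 2 := by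
        simp only [frameInnerC, Complex.re_sum, conj_mul', ← ofReal_pow, Complex.ofReal_re]
        rfl
      rw [← this, h, Complex.zero_re]
    intro s
    have := (Finset.sum_eq_zero_iff_of_nonneg fun s _ ↦ by positivity).1 hsum s (Finset.mem_univ _)
    simpa using this
  -- real and imaginary parts vanish by real definiteness
  have hre : reCLM.compContinuousAlternatingMap B = 0 := by
    refine (innerChart_self_eq_zero_iff (I := 𝓘(ℝ, E)) (n := n) hy _).1 ?_
    simp only [innerChart, ContinuousLinearMap.compContinuousAlternatingMap_coe, Function.comp_apply, reCLM_apply]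
    exact Finset.sum_eq_zero fun s _ ↦ by
      have h0 : B (frameTuple p s y) = 0 := hs s
      change (B (frameTuple p s y)).re * (B (frameTuple p s y)).re = 0
      rw [h0, Complex.zero_re, mul_zero]
  have him : imCLM.compContinuousAlternatingMap B = 0 := by
    refine (innerChart_self_eq_zero_iff (I := 𝓘(ℝ, E)) (n := n) hy _).1 ?_
    simp only [innerChart, ContinuousLinearMap.compContinuousAlternatingMap_coe, Function.comp_apply, imCLM_apply]
    exact Finset.sum_eq_zero fun s _ ↦ by
      have h0 : B (frameTuple p s y) = 0 := hs s
      change (B (frameTuple p s y)).im * (B (frameTuple p s y)).im = 0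
      rw [h0, Complex.zero_im, mul_zero]
  ext v
  have h1 := congrArg (fun f : E [⋀^Fin j]→L[ℝ] ℝ ↦ f v) hre
  have h2 := congrArg (fun f : E [⋀^Fin j]→L[ℝ] ℝ ↦ f v) him
  simp only [ContinuousLinearMap.compContinuousAlternatingMap_coe, Function.comp_apply, reCLM_apply, imCLM_apply] at h1 h2
  exact Complex.ext (by simpa using h1) (by simpa using h2)

omit [T2Space M] [CompactSpace M]
  [IsContMDiffRiemannianBundle 𝓘(ℝ, E) ∞ E (fun x : M ↦ TangentSpace 𝓘(ℝ, E) x)]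
  [Fact (IsSmoothForm (riemannianVolumeForm o))] in
/-- **The weight operator is injective** at points of the chart target where the scalar weight is
nonzero. [cite: WarnerGTM94, 6.32 (2)] -/
theorem weightOp_injective (εs : ℝ) {y : E} (hy : y ∈ (extChartAt 𝓘(ℝ, E) p).target) (hw : scalarWeight o p A εs y ≠ 0) :
    Injective (weightOp o p A ι εs y) := by
  refine (injective_iff_map_eq_zero _).2 fun a ha ↦ ?_
  have h := inner_weightOp o p A ι εs y a a
  rw [ha, inner_zero_left] at h
  have h0 : frameInnerC (I := 𝓘(ℝ, E)) n j p y (ι.symm a) (ι.symm a) = 0 := by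
    rcases mul_eq_zero.1 h.symm with h1 | h1
    · exact absurd (by exact_mod_cast h1) hw
    · exact h1
  have := frameInnerC_self_eq_zero p hy _ h0
  simpa using congrArg ι this

omit [T2Space M] [CompactSpace M]
  [IsContMDiffRiemannianBundle 𝓘(ℝ, E) ∞ E (fun x : M ↦ TangentSpace 𝓘(ℝ, E) x)]
  [Fact (IsSmoothForm (riemannianVolumeForm o))] in
/-- The scalar weight does not vanish on the chart target when the sign constant is `±`-valid
(`εs ≠ 0`). [folklore] -/
theorem scalarWeight_ne_zero {εs : ℝ} (hε : εs ≠ 0) {y : E} (hy : y ∈ (extChartAt 𝓘(ℝ, E) p).target) :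
    scalarWeight o p A εs y ≠ 0 := by
  have hne := inChart_riemannianVolumeForm_apply_ne_zero_of_mem_target (o := o) p hy
  have hc := cubeMapFactor_pos A (extChartAt 𝓘(ℝ, E) p p) (modelBasis E n)
  simp only [scalarWeight]
  exact mul_ne_zero (mul_ne_zero hε (by exact_mod_cast hc.ne')) hne

omit [T2Space M] [CompactSpace M]
  [IsContMDiffRiemannianBundle 𝓘(ℝ, E) ∞ E (fun x : M ↦ TangentSpace 𝓘(ℝ, E) x)]
  [Fact (IsSmoothForm (riemannianVolumeForm o))] in
/-- **The weight operator is a unit** of the endomorphism ring at such points. [folklore] -/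
theorem isUnit_weightOp (εs : ℝ) {y : E} (hy : y ∈ (extChartAt 𝓘(ℝ, E) p).target) (hw : scalarWeight o p A εs y ≠ 0) :
    IsUnit (weightOp o p A ι εs y) := by
  rw [ContinuousLinearMap.isUnit_iff_bijective]
  have hinj := weightOp_injective o p A ι εs hy hw
  refine ⟨hinj, ?_⟩
  have : Surjective ((weightOp o p A ι εs y : EuclideanSpace ℂ (Fin N) →L[ℝ] EuclideanSpace ℂ (Fin N)).toLinearMap) :=
    LinearMap.injective_iff_surjective.1 hinj
  exact this

/-- **The inverse weight** `W(y)⁻¹` (ring inverse; the honest inverse on the chart target). [cite: WarnerGTM94, 6.32] -/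
def weightInv (εs : ℝ) (y : E) : EuclideanSpace ℂ (Fin N) →L[ℝ] EuclideanSpace ℂ (Fin N) :=
  Ring.inverse (weightOp o p A ι εs y)

omit [T2Space M] [CompactSpace M]
  [IsContMDiffRiemannianBundle 𝓘(ℝ, E) ∞ E (fun x : M ↦ TangentSpace 𝓘(ℝ, E) x)]
  [Fact (IsSmoothForm (riemannianVolumeForm o))] in
/-- `W(y) (W(y)⁻¹ v) = v` on the chart target. [folklore] -/
theorem weightOp_weightInv (εs : ℝ) {y : E} (hy : y ∈ (extChartAt 𝓘(ℝ, E) p).target) (hw : scalarWeight o p A εs y ≠ 0)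
    (v : EuclideanSpace ℂ (Fin N)) : weightOp o p A ι εs y (weightInv o p A ι εs y v) = v := by
  have h := Ring.mul_inverse_cancel _ (isUnit_weightOp o p A ι εs hy hw)
  have := congrArg (fun f : EuclideanSpace ℂ (Fin N) →L[ℝ] EuclideanSpace ℂ (Fin N) ↦ f v) h
  simpa [weightInv] using this

omit [T2Space M] [CompactSpace M] in
/-- **The inverse weight is smooth on the chart target** (ring inversion is smooth at units).
[folklore] -/
theorem contDiffOn_weightInv {εs : ℝ} (hε : εs ≠ 0) :
    ContDiffOn ℝ ∞ (weightInv o p A ι εs) (extChartAt 𝓘(ℝ, E) p).target := fun y hy ↦ by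
  have hu := isUnit_weightOp o p A ι εs hy (scalarWeight_ne_zero o p A hε hy)
  have h1 : ContDiffAt ℝ ∞ Ring.inverse (weightOp o p A ι εs y) := by
    have := contDiffAt_ringInverse ℝ (n := ∞) hu.unit
    rwa [IsUnit.unit_spec] at this
  exact h1.comp_contDiffWithinAt y (contDiffOn_weightOp o ι εs y hy)

end WeightInv

/-! ### Closed supports inside repr-balls -/

section Supp

variable {n : ℕ} {V : Type*} [Zero V]

/-- If `f` vanishes where `repr ∉ closedBall a` then `tsupport f ⊆ {repr ∈ ball b}` for `a < b < ½`
(the closed level set `{ω_{a,b} = 1}` separates them). [folklore] -/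
theorem Torus.tsupport_subset_of_repr {a b : ℝ} (ha : 0 < a) (hab : a < b) (hb : b < 1 / 2) {f : UnitAddTorus (Fin n) → V}
    (hf : ∀ x, f x ≠ 0 → Torus.repr x ∈ closedBall (Torus.cubeCenter (Fin n)) a) :
    tsupport f ⊆ {x | Torus.repr x ∈ ball (Torus.cubeCenter (Fin n)) b} := by
  set η := Torus.radialCutoff (n := n) ha hab with hη
  have hηc : Continuous η := (Torus.isSmooth_radialCutoff ha hab hb).continuous
  have h1 : support f ⊆ {x | η x = 1} := fun x hx ↦ Torus.radialCutoff_eq_one ha hab hb (hf x hx)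
  refine (closure_minimal h1 (isClosed_eq hηc continuous_const)).trans fun x (hx : η x = 1) ↦ ?_
  by_contra hc
  have h0 : η x = 0 := Torus.radialCutoff_eq_zero ha hab hb hc
  rw [h0] at hx
  exact zero_ne_one hx

end Supp

/-! ### The periodised inverse weight and the local representative -/

section LocalRepr

variable {E : Type*} [NormedAddCommGroup E] [NormedSpace ℂ E] [FiniteDimensional ℂ E]
  {n : ℕ} [Fact (finrank ℝ E = n)] [MeasurableSpace E] [BorelSpace E]
  {M : Type*} [TopologicalSpace M] [ChartedSpace E M] [T2Space M] [CompactSpace M]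
  [IsManifold 𝓘(ℝ, E) ∞ M] [RiemannianBundle (fun x : M ↦ TangentSpace 𝓘(ℝ, E) x)]
  [IsContMDiffRiemannianBundle 𝓘(ℝ, E) ∞ E (fun x : M ↦ TangentSpace 𝓘(ℝ, E) x)]
  (o : (x : M) → Orientation ℝ (TangentSpace 𝓘(ℝ, E) x) (Fin n)) {K N : ℕ}
  [Fact (IsSmoothForm (riemannianVolumeForm o))]
  {p : M} {A : E ≃L[ℝ] EuclideanSpace ℝ (Fin n)} (ι : (E [⋀^Fin K]→L[ℝ] ℂ) ≃L[ℂ] EuclideanSpace ℂ (Fin N))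
  (𝒞 : CubeCutoff p A)

/-- The cut-off inverse weight on `ℝⁿ`. [folklore] -/
def weightInvFun (εs : ℝ) : EuclideanSpace ℝ (Fin n) → (EuclideanSpace ℂ (Fin N) →L[ℝ] EuclideanSpace ℂ (Fin N)) := fun z ↦
  𝒞.χ z • weightInv o p A ι εs ((cubeMap A (extChartAt 𝓘(ℝ, E) p p)).symm z)

/-- **The periodised inverse weight** `W̃⁻¹`. [cite: WarnerGTM94, 6.32] -/
def weightInvPer (εs : ℝ) : UnitAddTorus (Fin n) → (EuclideanSpace ℂ (Fin N) →L[ℝ] EuclideanSpace ℂ (Fin N)) :=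
  Torus.periodize (weightInvFun o ι 𝒞 εs)

omit [T2Space M] [CompactSpace M] in
/-- `W̃⁻¹` is smooth (for `εs ≠ 0`). [folklore] -/
theorem isSmooth_weightInvPer {εs : ℝ} (hε : εs ≠ 0) : Torus.IsSmooth (weightInvPer o ι 𝒞 εs) := by
  refine Torus.isSmooth_periodize (contDiff_smul_of_tsupport_subset (CubeCutoff.isOpen_preimage_target p A) 𝒞.contDiff
    𝒞.tsupport_subset_preimage ((contDiffOn_weightInv o p A ι hε).comp (contDiff_cubeMap_symm A _).contDiffOn fun _ hz ↦ hz))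
    (R := Fintype.card (Fin n)) ?_
  exact Torus.tsupport_subset_closedBall_of_openCube (((tsupport_smul_subset_left _ _).trans 𝒞.tsupport_subset).trans
    (closedBall_cubeCenter_subset 𝒞.ρ'_lt))

omit [T2Space M] [CompactSpace M] [IsContMDiffRiemannianBundle 𝓘(ℝ, E) ∞ E (fun x : M ↦ TangentSpace 𝓘(ℝ, E) x)]
  [Fact (IsSmoothForm (riemannianVolumeForm o))] in
/-- `W̃⁻¹ x = W(Φ⁻¹ repr x)⁻¹` where `repr x ∈ closedBall c₀ ρ`. [folklore] -/
theorem weightInvPer_apply_of_mem (εs : ℝ) {x : UnitAddTorus (Fin n)}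
    (hx : Torus.repr x ∈ closedBall (Torus.cubeCenter (Fin n)) 𝒞.ρ) :
    weightInvPer o ι 𝒞 εs x = weightInv o p A ι εs ((cubeMap A (extChartAt 𝓘(ℝ, E) p p)).symm (Torus.repr x)) := by
  rw [weightInvPer, Torus.periodize_eq_apply_repr (fun z hz ↦ by simp [weightInvFun, 𝒞.eq_zero_of_not hz]), weightInvFun,
    𝒞.eq_one _ hx, one_smul]

omit [MeasurableSpace E] [BorelSpace E] [T2Space M] [CompactSpace M]
  [IsContMDiffRiemannianBundle 𝓘(ℝ, E) ∞ E (fun x : M ↦ TangentSpace 𝓘(ℝ, E) x)] [Fact (IsSmoothForm (riemannianVolumeForm o))] in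
/-- A valid sign constant is nonzero (the centre of the chart lies in every cube region). [folklore] -/
theorem sign_ne_zero {εs : ℝ} (hsign : ∀ y ∈ cubeRegion A (extChartAt 𝓘(ℝ, E) p p) 𝒞.ρ, chartSign o p y = εs) : εs ≠ 0 := by
  have h0 : extChartAt 𝓘(ℝ, E) p p ∈ cubeRegion A (extChartAt 𝓘(ℝ, E) p p) 𝒞.ρ := by
    rw [mem_cubeRegion_iff, cubeMap_self]; exact mem_closedBall_self 𝒞.ρ_pos.le
  rw [← hsign _ h0, chartSign_eq_sign_inChart_riemannianVolumeForm]
  have hne := inChart_riemannianVolumeForm_apply_ne_zero_of_mem_target (o := o) p (mem_extChartAt_target p)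
  rcases lt_or_gt_of_ne hne with h | h
  · rw [Real.sign_of_neg h]; norm_num
  · rw [Real.sign_of_pos h]; norm_num

/-- **The local smooth representative** (Warner 6.32, conclusion of the local step): under the
hypotheses of `exists_smooth_plateau_local` there is a smooth `K`-form `u` on `M` with
`ℓ(mk t) = ⟪mk u, mk t⟫` for every smooth `t` supported in the chart preimage of the cube region of
radius `ρ/8`. [cite: WarnerGTM94, 6.32] -/
theorem exists_local_repr {εs : ℝ} (hsign : ∀ y ∈ cubeRegion A (extChartAt 𝓘(ℝ, E) p p) 𝒞.ρ, chartSign o p y = εs)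
    (Δ : MForm 𝓘(ℝ, E) M ℂ K → MForm 𝓘(ℝ, E) M ℂ K) (hΔs : ∀ {β}, IsSmoothForm β → IsSmoothForm (Δ β))
    (hΔsupp : ∀ {β : MForm 𝓘(ℝ, E) M ℂ K} {r : ℝ}, IsSmoothForm β → r ≤ 𝒞.ρ →
      (∀ x, β x ≠ 0 → x ∈ (extChartAt 𝓘(ℝ, E) p).source ∧
        extChartAt 𝓘(ℝ, E) p x ∈ cubeRegion A (extChartAt 𝓘(ℝ, E) p p) r) →
      ∀ x, Δ β x ≠ 0 → x ∈ (extChartAt 𝓘(ℝ, E) p).source ∧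
        extChartAt 𝓘(ℝ, E) p x ∈ cubeRegion A (extChartAt 𝓘(ℝ, E) p p) r)
    (ΔL : CL2SmoothForms o K → CL2SmoothForms o K)
    (hΔL : ∀ φ, CL2SmoothForms.toForm o (ΔL φ) = Δ (CL2SmoothForms.toForm o φ))
    (Lop Ladj : Lattice.POp (Fin n) (EuclideanSpace ℂ (Fin N)) (EuclideanSpace ℂ (Fin N)))
    (hagree : ∀ {β : MForm 𝓘(ℝ, E) M ℂ K}, IsSmoothForm β →
      (∀ x, β x ≠ 0 → x ∈ (extChartAt 𝓘(ℝ, E) p).source ∧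
        extChartAt 𝓘(ℝ, E) p x ∈ cubeRegion A (extChartAt 𝓘(ℝ, E) p p) 𝒞.ρ) →
      mFourierCoeff (MForm.toTorus p A ((ι : (E [⋀^Fin K]→L[ℝ] ℂ) →L[ℂ] EuclideanSpace ℂ (Fin N)).restrictScalars ℝ) (Δ β)) =
        Lop.apply (mFourierCoeff (MForm.toTorus p A ((ι : (E [⋀^Fin K]→L[ℝ] ℂ) →L[ℂ] EuclideanSpace ℂ (Fin N)).restrictScalars ℝ) β)))
    (hdual : ∀ {u v : (Fin n → ℤ) → EuclideanSpace ℂ (Fin N)}, Lattice.Tempered u → RapidDecay v →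
      Lattice.pairing (Ladj.apply u) v = Lattice.pairing u (Lop.apply v))
    {κ : ℝ} (hκ : 0 < κ) (hell : Ladj.IsEllipticWith κ) {ε : ℝ≥0∞} (hpert : Ladj.PrincipalPerturbationLE ε)
    (hε : ENNReal.ofReal (2 * Real.sqrt 2 / κ) * (Fintype.card (Fin n) : ℝ≥0∞) ^ 2 * ε ≤ 1)
    (α : CL2SmoothForms o K) (ℓ : CL2SmoothForms o K →L[ℂ] ℂ) (hweakM : ∀ φ, ℓ (ΔL φ) = ⟪α, φ⟫) :
    ∃ (u : MForm 𝓘(ℝ, E) M ℂ K) (hu : IsSmoothForm u), ∀ (t : MForm 𝓘(ℝ, E) M ℂ K) (ht : IsSmoothForm t),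
      (∀ x, t x ≠ 0 → x ∈ (extChartAt 𝓘(ℝ, E) p).source ∧
        extChartAt 𝓘(ℝ, E) p x ∈ cubeRegion A (extChartAt 𝓘(ℝ, E) p p) (𝒞.ρ / 8)) →
      ℓ (CL2SmoothForms.mk o t ht) = ⟪CL2SmoothForms.mk o u hu, CL2SmoothForms.mk o t ht⟫ := by
  have hr := localRadii 𝒞
  have hc := chainRadii 𝒞
  have hεs : εs ≠ 0 := sign_ne_zero o 𝒞 hsign
  have hKt34 : cubeRegion A (extChartAt 𝓘(ℝ, E) p p) (3 * 𝒞.ρ / 4) ⊆ (extChartAt 𝓘(ℝ, E) p).target :=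
    cubeRegion_subset_target 𝒞 hr.2.2.2.le
  -- `ũ` and `u₀`
  obtain ⟨û, hû0, hû⟩ := exists_repr_localFunctional o ι 𝒞 ℓ hsign
  obtain ⟨u₀, hu₀s, hu₀⟩ := exists_smooth_plateau_local o ι 𝒞 hsign Δ hΔs hΔsupp ΔL hΔL Lop Ladj hagree hdual hκ hell
    hpert hε α ℓ hweakM hû0 hû
  -- the representative `u = S(w₀ · W̃⁻¹ u₀)`
  set h : UnitAddTorus (Fin n) → EuclideanSpace ℂ (Fin N) := fun x ↦ localCutoff 𝒞 x • weightInvPer o ι 𝒞 εs x (u₀ x) with hh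
  have hhs : Torus.IsSmooth h :=
    (Torus.isSmooth_radialCutoff _ _ hr.2.2.1).smul_complex (ContDiff.clm_apply (isSmooth_weightInvPer o ι 𝒞 hεs) hu₀s)
  have hhsupp := localCutoff_smul_support 𝒞 (fun x ↦ weightInvPer o ι 𝒞 εs x (u₀ x))
  refine ⟨MForm.ofTorus p A (realEquiv ι) h, isSmoothForm_ofTorus (realEquiv ι) hr.2.2.1 hKt34 hhs hhsupp, fun t ht hKt8 ↦ ?_⟩
  -- the test function on the torus
  have h8 : 𝒞.ρ / 8 < 1 / 2 := by linarith [hc.2.2.1]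
  have hKt8' : cubeRegion A (extChartAt 𝓘(ℝ, E) p p) (𝒞.ρ / 8) ⊆ (extChartAt 𝓘(ℝ, E) p).target :=
    cubeRegion_subset_target 𝒞 (by linarith [𝒞.ρ_pos])
  have hKtρ : ∀ x, t x ≠ 0 → x ∈ (extChartAt 𝓘(ℝ, E) p).source ∧
      extChartAt 𝓘(ℝ, E) p x ∈ cubeRegion A (extChartAt 𝓘(ℝ, E) p p) 𝒞.ρ := fun x hx ↦
    ⟨(hKt8 x hx).1, cubeRegion_mono (by linarith [𝒞.ρ_pos]) (hKt8 x hx).2⟩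
  set ψ := MForm.toTorus p A ((ι : (E [⋀^Fin K]→L[ℝ] ℂ) →L[ℂ] EuclideanSpace ℂ (Fin N)).restrictScalars ℝ) t with hψdef
  have hψs : Torus.IsSmooth ψ := MForm.isSmooth_toTorus _ 𝒞.ρ_lt_half ht 𝒞.region_subset' hKtρ
  have hψsupp : ∀ x, ψ x ≠ 0 → Torus.repr x ∈ closedBall (Torus.cubeCenter (Fin n)) (𝒞.ρ / 8) := fun x hx ↦
    MForm.toTorus_support _ hKt8 x hx
  have hψr : RapidDecay (mFourierCoeff ψ) := hψs.rapidDecay_mFourierCoeff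
  have hcoe := coe_realEquiv ι
  -- `t = S ψ` and `localForm ψ̂ = t`
  have hSt : MForm.ofTorus p A (realEquiv ι) ψ = t := by
    rw [hψdef, ← hcoe]; exact MForm.ofTorus_toTorus (realEquiv ι) h8 hKt8
  have hloc : localForm ι 𝒞 (mFourierCoeff ψ) = t := by
    have h1 : Torus.fourierSynth (mFourierCoeff ψ) = ψ :=
      Torus.fourierSynth_mFourierCoeff_of_summable hψs.continuous hψr.summable_norm
    have h2 : (fun x ↦ localCutoff 𝒞 x • Torus.fourierSynth (mFourierCoeff ψ) x) = ψ := by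
      rw [h1]; funext x
      by_cases hx : ψ x = 0
      · rw [hx, smul_zero]
      · rw [localCutoff, Torus.radialCutoff_eq_one _ _ hr.2.2.1
          (closedBall_subset_closedBall (by linarith [𝒞.ρ_pos]) (hψsupp x hx)), one_smul]
    rw [localForm, h2, hSt]
  -- `ℓ(mk t) = ⟨ũ, ψ̂⟩`
  have hl : ℓ (CL2SmoothForms.mk o t ht) = Lattice.pairing û (mFourierCoeff ψ) := by
    have h1 := hû ⟨mFourierCoeff ψ, hψr⟩
    rw [localFunctional_apply] at h1
    change ℓ (CL2SmoothForms.mk o (localForm ι 𝒞 (mFourierCoeff ψ)) (isSmoothForm_localForm ι 𝒞 hψr)) =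
      Lattice.pairing û (mFourierCoeff ψ) at h1
    rw [← h1]
    congr 1
    exact (CL2SmoothForms.toForm_inj o).1 (by rw [CL2SmoothForms.toForm_mk, CL2SmoothForms.toForm_mk, hloc])
  -- `⟨ũ, ψ̂⟩ = ⟨𝓕u₀, ψ̂⟩ = ∫ ⟪u₀, ψ⟫` via the plateau `ω∞ = 1` on `supp ψ`
  set wInf := Torus.radialPlateau (n := n) hc.1 with hwInf
  have hwInfs : Torus.IsSmooth wInf := Torus.isSmooth_radialPlateau hc.1 (hc.2.1.trans hc.2.2.1)
  have hψw : (fun x ↦ wInf x • ψ x) = ψ := by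
    funext x
    by_cases hx : ψ x = 0
    · rw [hx, smul_zero]
    · rw [hwInf, Torus.radialPlateau_eq_one hc.1 (hc.2.1.trans hc.2.2.1) (by
        have := hψsupp x hx; rwa [show 𝒞.ρ / 4 / 2 = 𝒞.ρ / 8 by ring]), one_smul]
  have hpair : Lattice.pairing û (mFourierCoeff ψ) = ∫ x, ⟪u₀ x, ψ x⟫ := by
    obtain ⟨θ, hθ⟩ : ∃ θ : UnitAddTorus (Fin n) → ℝ, wInf = fun x ↦ (θ x : ℂ) :=
      ⟨_, Torus.radialCutoff_eq_ofReal _ _ (hc.2.1.trans hc.2.2.1)⟩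
    have hreal : Lattice.adjSymb (Lattice.scal (mFourierCoeff wInf) : (Fin n → ℤ) →
        (EuclideanSpace ℂ (Fin N) →L[ℂ] EuclideanSpace ℂ (Fin N))) = Lattice.scal (mFourierCoeff wInf) := by
      rw [hθ]; exact Lattice.adjSymb_scal_ofReal θ
    have h1 : mFourierCoeff ψ = Lattice.conv (Lattice.scal (mFourierCoeff wInf)) (mFourierCoeff ψ) := by
      conv_lhs => rw [← hψw]
      exact hwInfs.mFourierCoeff_smul_eq_conv_scal hψs
    rw [h1, Lattice.pairing_conv_right hwInfs.rapidDecay_scal (s := 0) hû0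
        (by rw [neg_zero]; exact Lattice.eNormSq_lt_top_of_rapidDecay hψr 0), hreal, ← hu₀,
      Torus.pairing_mFourierCoeff_eq_integral_inner hu₀s.continuous hψs.continuous]
  -- `⟪mk u, mk t⟫ = ∫ ⟪u₀, ψ⟫`
  have hTu : MForm.toTorus p A ((ι : (E [⋀^Fin K]→L[ℝ] ℂ) →L[ℂ] EuclideanSpace ℂ (Fin N)).restrictScalars ℝ)
      (MForm.ofTorus p A (realEquiv ι) h) = h := by
    rw [← hcoe]; exact MForm.toTorus_ofTorus (realEquiv ι) hr.2.2.1 hKt34 hhsupp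
  have hW : ∀ x, ⟪weightOp o p A ι εs ((cubeMap A (extChartAt 𝓘(ℝ, E) p p)).symm (Torus.repr x))
      (MForm.toTorus p A ((ι : (E [⋀^Fin K]→L[ℝ] ℂ) →L[ℂ] EuclideanSpace ℂ (Fin N)).restrictScalars ℝ)
        (MForm.ofTorus p A (realEquiv ι) h) x), ψ x⟫ = ⟪u₀ x, ψ x⟫ := fun x ↦ by
    rw [hTu]
    by_cases hx : ψ x = 0
    · simp [hx]
    · have hx8 := hψsupp x hx
      have hxρ : Torus.repr x ∈ closedBall (Torus.cubeCenter (Fin n)) 𝒞.ρ :=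
        closedBall_subset_closedBall (by linarith [𝒞.ρ_pos]) hx8
      have hy : (cubeMap A (extChartAt 𝓘(ℝ, E) p p)).symm (Torus.repr x) ∈ (extChartAt 𝓘(ℝ, E) p).target :=
        𝒞.region_subset' (by rw [mem_cubeRegion_iff, Homeomorph.apply_symm_apply]; exact hxρ)
      simp only [hh]
      rw [localCutoff, Torus.radialCutoff_eq_one _ _ hr.2.2.1 (closedBall_subset_closedBall (by linarith [𝒞.ρ_pos]) hx8),
        one_smul, weightInvPer_apply_of_mem o ι 𝒞 εs hxρ,
        weightOp_weightInv o p A ι εs hy (scalarWeight_ne_zero o p A hεs hy)]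
  rw [hl, hpair, CL2SmoothForms.inner_mk_eq_integral_inner_weightOp o ι 𝒞 hsign _ ht hKtρ,
    integral_congr_ae (Eventually.of_forall hW)]

end LocalRepr

end Literature.Geometry.Kaehler
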